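import Summits.QuantumFields.YangMills.Theorems.BalabanUVNodesRateCarriersOfRecord13CoPH
import Literature.MathematicalPhysics.QuantumFieldTheory.Balaban1983to89.Node00.Record13CoPHChi

/-!
# THE STAGE-13 RATE READING AND THE RATE-CARRIER BUNDLE OF RECORD, RE-ISSUED CENTRE-MAP-GENERIC («Cmap») WITH THE RE-CENTRED («Ax») INSTANCE — op 5c supply T1
# (plan g99 `D99-KAX/OP5C-SUPPLY-CENSUS-K3v8.md` §2 rows 1–2, §3 shapes) for crux K3ᴬ `SpineGivenEndpointR13SepCoPHVAx` (stmt-QuantumFields-27247)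

Cell `pub-ymgap` (HUMAN RULING D-0062 Track A; WORK ORDER RC-1, director-ym №462∕№467∕№477; dag-lead HANDS-4 (a)).  `--supports stmt-QuantumFields-27247 --as helper`
(count-neutral).  NEW basename beside the UNTOUCHED parent `Thm/BalabanUVNodesRateCarriersOfRecord13CoPH` (T-RATE pen, n22-e lineage, ns `YMDAG.UVSplit`); the
[Ax-3c]∕[Ax-3d] pattern of `Node00/Record13CoPHChi` applied to the parent's §2 READING TYPE and BUNDLE: the structure `RateReading₁₃CoPH N` (fields `lit ∕ ne1` over the
binder `θ.Provisos₁₃CoPH F N`) re-issued as `RateReading₁₃CoPHCmap N Χ` over a CENTRE MAP `Χ : (F : T4Family) → Stage13Params F N → ChiSlot F N` (fields over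
`θ.Provisos₁₃CoPHChi F N (Χ F θ.toStage13Params)`), the bundle `rateCarriersOfRecord₁₃CoPH` (:130) as `rateCarriersOfRecord₁₃CoPHCmap` (body VERBATIM), the proviso-free
embedding `RateReading₁₃CoPHCmap.ofAssignment` (+ `rfl` faces), the bundle's component faces (`rfl`), and the Ax instances `RateReading₁₃CoPHAx N := RateReading₁₃CoPHCmap N
(fun F => chiβOfRecord₁₃Ax F N)` ∕ `rateCarriersOfRecord₁₃CoPHAx` (`abbrev`).  NOT re-issued: the datum-KEYED predicate `RRec₁₃CoPH` and its faces (§2–§4 of the parent) —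
they read the record-class ∕ datum-key layer (`IsDatumOfRecord₁₃CCoPH`), which RC-1 does not re-issue (node00-def-RR-2 g26, pub-ymgap INBOX «(β)»); nothing landed is edited.

WHY.  K3ᴬ's text binds `(h : θ.Provisos₁₃SepCoPHAx F 2)`; the K3 v7 skeleton's readings `𝔯 : RateReading₁₃CoPH 2` apply `𝔯.lit ∕ 𝔯.ne1` at `hP : θ.Provisos₁₃CoPH F 2` (29 binder
sites, plan g99 §2 row 1) — the v8 skeleton over the Ax tuple needs the reading typed over `θ.Provisos₁₃CoPHAx` (= `θ.Provisos₁₃CoPHChi F 2 (chiβOfRecord₁₃Ax F 2 θ)`,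
`Node00/Record13CoPHChi` :507).  This file is the type every HANDS-4 (b)∕(c) row imports (R9∕R10∕R11∕R12∕R13∕R17∕R18).

HONEST FRAMING.  Definitions re-issued over a parameter + `rfl` faces; no law assumed on the reading; nothing of Bałaban asserted, ported or discharged; K3ᴬ OPEN (skeleton
unregistered at filing); counts UNMOVED (typed 28∕28 · discharged 8∕27, A 8∕28); no `sorry`∕`instance`∕`notation`; standard axioms; one finite four-torus programme at fixed `ε` —
NOT ℝ⁴, NOT infinite volume, NOT OS, NOT a mass gap, NOT Clay.
-/

set_option autoImplicit false

noncomputable section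

namespace YMDAG.UVSplit

open Literature.MathematicalPhysics.QuantumFieldTheory.Balaban1983to89
open Literature.MathematicalPhysics.QuantumFieldTheory.Balaban1983to89.T4Continuum (T4Family ULoop)
open Node00 (Stage13Params Stage13HParams ChiSlot chiβOfRecord₁₃Ax RateObjects₁₁ RateAssignment₁₃)

variable {N : ℕ} [NeZero N]

/-! ## §1 The centre-map-generic Stage-13 rate reading and the Ax instance -/

/-- **A STAGE-13 RATE READING OVER A CENTRE MAP `Χ`**: the two RESIDUAL assignments the rate carriers of record are read from — layer A's rate objects `lit` and N14's
dressed tower `ne1` — AT A STAGE-13 TUPLE WITH ITS χ-PROVISOS `θ.Provisos₁₃CoPHChi F N (Χ F θ.toStage13Params)` ([Ax-3c] `Node00/Record13CoPHChi`).  VERBATIM the parent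
`RateReading₁₃CoPH` with the proviso binder re-keyed; parameters of this file, pinned later BY NAME; no law assumed. -/
structure RateReading₁₃CoPHCmap (N : ℕ) [NeZero N] (Χ : (F : T4Family) → Stage13Params F N → ChiSlot F N) where
  /-- layer A's rate objects per `(F, θ, hP, g₀, os)` -/
  lit : (F : T4Family) → (θ : Stage13HParams F N) → θ.Provisos₁₃CoPHChi F N (Χ F θ.toStage13Params) → (ℕ → ℝ) → List (ULoop F) → RateObjects₁₁ N
  /-- N14's dressed-tower carriers per `(F, θ, hP, g₀, os)` -/
  ne1 : (F : T4Family) → (θ : Stage13HParams F N) → θ.Provisos₁₃CoPHChi F N (Χ F θ.toStage13Params) → (ℕ → ℝ) → List (ULoop F) → NE1pCarriers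

/-- **THE STAGE-13 RATE READING OF THE RE-CENTRED RECORD** (instance `Χ := fun F => chiβOfRecord₁₃Ax F N`; its proviso binder is `θ.Provisos₁₃CoPHAx F N` by `rfl`) — the
reading type of the K3ᴬ v8 skeleton. -/
abbrev RateReading₁₃CoPHAx (N : ℕ) [NeZero N] : Type _ := RateReading₁₃CoPHCmap N (fun F => chiβOfRecord₁₃Ax F N)

namespace RateReading₁₃CoPHCmap

variable {Χ : (F : T4Family) → Stage13Params F N → ChiSlot F N}

/-- **EMBEDDING OF A PROVISO-FREE ASSIGNMENT** (RR-2's `RateAssignment₁₃`) with a proviso-free dressed-tower assignment: forget the χ-provisos (VERBATIM the parent's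
`RateReading₁₃CoPH.ofAssignment`). -/
def ofAssignment (a : RateAssignment₁₃ N) (ne1 : (F : T4Family) → Stage13HParams F N → (ℕ → ℝ) → List (ULoop F) → NE1pCarriers) : RateReading₁₃CoPHCmap N Χ :=
  ⟨fun F θ _ g₀ os => a F θ.toStage13Params g₀ os, fun F θ _ g₀ os => ne1 F θ g₀ os⟩

/-- Its rate objects are the assignment's (`rfl`). -/
theorem ofAssignment_lit (a : RateAssignment₁₃ N) (ne1 : (F : T4Family) → Stage13HParams F N → (ℕ → ℝ) → List (ULoop F) → NE1pCarriers)
    (F : T4Family) (θ : Stage13HParams F N) (hP : θ.Provisos₁₃CoPHChi F N (Χ F θ.toStage13Params)) (g₀ : ℕ → ℝ) (os : List (ULoop F)) :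
    (ofAssignment (Χ := Χ) a ne1).lit F θ hP g₀ os = a F θ.toStage13Params g₀ os := rfl

/-- Its dressed-tower carriers are the assignment's (`rfl`). -/
theorem ofAssignment_ne1 (a : RateAssignment₁₃ N) (ne1 : (F : T4Family) → Stage13HParams F N → (ℕ → ℝ) → List (ULoop F) → NE1pCarriers)
    (F : T4Family) (θ : Stage13HParams F N) (hP : θ.Provisos₁₃CoPHChi F N (Χ F θ.toStage13Params)) (g₀ : ℕ → ℝ) (os : List (ULoop F)) :
    (ofAssignment (Χ := Χ) a ne1).ne1 F θ hP g₀ os = ne1 F θ g₀ os := rfl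

end RateReading₁₃CoPHCmap

/-! ## §2 The rate-carrier bundle of record read from a centre-map-generic reading, and its faces -/

variable {Χ : (F : T4Family) → Stage13Params F N → ChiSlot F N}

/-- **THE STAGE-13 RATE-CARRIER BUNDLE OF RECORD AT RUN LENGTH `k`** read from a centre-map-generic reading `𝔯` at `(F, θ, hP, g₀, os)` — VERBATIM the parent's
`rateCarriersOfRecord₁₃CoPH` (:130): `ne1` from `𝔯.ne1`, NE2 ∕ NE3 layers of `𝔯.lit` through layer B, node U3's bundle `u3OfRecord₁₃ θ.toStage13Params (𝔯.lit …).u3 k`. -/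
def rateCarriersOfRecord₁₃CoPHCmap (𝔯 : RateReading₁₃CoPHCmap N Χ) (F : T4Family) (θ : Stage13HParams F N) (hP : θ.Provisos₁₃CoPHChi F N (Χ F θ.toStage13Params))
    (g₀ : ℕ → ℝ) (os : List (ULoop F)) (k : ℕ) : RateCarriers N :=
  ⟨𝔯.ne1 F θ hP g₀ os, ne2OfRecord₁₁ ((𝔯.lit F θ hP g₀ os).ne2 k), ne3OfRecord₁₁ F ((𝔯.lit F θ hP g₀ os).ne3 k),
    u3OfRecord₁₃ θ.toStage13Params (𝔯.lit F θ hP g₀ os).u3 k⟩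

/-- **The bundle of the RE-CENTRED record** (instance; `rateCarriersOfRecord₁₃CoPHCmap` at an Ax reading, binder `θ.Provisos₁₃CoPHAx F N`). -/
abbrev rateCarriersOfRecord₁₃CoPHAx (𝔯 : RateReading₁₃CoPHAx N) (F : T4Family) (θ : Stage13HParams F N) (hP : θ.Provisos₁₃CoPHAx F N) (g₀ : ℕ → ℝ)
    (os : List (ULoop F)) (k : ℕ) : RateCarriers N :=
  rateCarriersOfRecord₁₃CoPHCmap 𝔯 F θ hP g₀ os k

section Faces

variable (𝔯 : RateReading₁₃CoPHCmap N Χ) (F : T4Family) (θ : Stage13HParams F N) (hP : θ.Provisos₁₃CoPHChi F N (Χ F θ.toStage13Params)) (g₀ : ℕ → ℝ)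
  (os : List (ULoop F)) (k : ℕ)

/-- Face (`rfl`): the bundle's N14 carriers are `𝔯.ne1 …`. -/
theorem rateCarriersOfRecord₁₃CoPHCmap_ne1 : (rateCarriersOfRecord₁₃CoPHCmap 𝔯 F θ hP g₀ os k).ne1 = 𝔯.ne1 F θ hP g₀ os := rfl

/-- Face (`rfl`): the bundle's N15 component is layer B's `ne2OfRecord₁₁` of the reading's NE2 layer at run length `k`. -/
theorem rateCarriersOfRecord₁₃CoPHCmap_ne2 : (rateCarriersOfRecord₁₃CoPHCmap 𝔯 F θ hP g₀ os k).ne2 = ne2OfRecord₁₁ ((𝔯.lit F θ hP g₀ os).ne2 k) := rfl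

/-- Face (`rfl`): the bundle's N16 component is layer B's `ne3OfRecord₁₁ F` of the reading's NE3 layer at run length `k`. -/
theorem rateCarriersOfRecord₁₃CoPHCmap_ne3 : (rateCarriersOfRecord₁₃CoPHCmap 𝔯 F θ hP g₀ os k).ne3 = ne3OfRecord₁₁ F ((𝔯.lit F θ hP g₀ os).ne3 k) := rfl

/-- Face (`rfl`): the bundle's node-U3 component is `u3OfRecord₁₃ θ.toStage13Params (𝔯.lit …).u3 k`. -/
theorem rateCarriersOfRecord₁₃CoPHCmap_u3 :
    (rateCarriersOfRecord₁₃CoPHCmap 𝔯 F θ hP g₀ os k).u3 = u3OfRecord₁₃ θ.toStage13Params (𝔯.lit F θ hP g₀ os).u3 k := rfl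

end Faces

end YMDAG.UVSplit

end
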